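import Literature.ModelTheory.ExponentialFields.RealExpModels
import Literature.ModelTheory.ExponentialFields.Wilkie1989
import Mathlib.Analysis.Calculus.ContDiff.RCLike
import Mathlib.Analysis.SpecialFunctions.ExpDeriv
import Mathlib.Analysis.Calculus.Deriv.Pi
import Mathlib.LinearAlgebra.Matrix.Determinant.Basic
import HarnessLib

/-!
# Transfer between `ℝ_exp` and the models of `T_exp`: formulas, exponential terms as smooth functions

Trunk `TranscendEllArithS`, family `periods` (periods.S28), infrastructure for the decomposition of
the named fact `Literature.ModelTheory.ExponentialFields.wilkie_isModelComplete` (`RealExpField.lean`) along A. J. Wilkie, *On the theory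
of the real exponential field*, Illinois J. Math. 33 (1989), whose §2 ("Transfer", p. 387) reads:
"Since `K ⊨ T` we may use results from calculus (say) when working in `K` provided such results are
first-order expressible in `L` uniformly in any parameters that occur. When doing this we shall
simply use the phrase *by transfer*."  This file provides exactly that, proved (no named facts):

* `Literature.RealExpModel.LawfulStructure M`: a `Language.orderedExpRing`-structure on an ordered field
  `M` whose symbols `+, *, -, 0, 1, ≤` are interpreted by the field operations; instances for `ℝ`
  and for (the carrier of) every bundled model `K : realExpTheory.ModelType` (`RealExpModels.lean`).
  All realization lemmas below are proved once for lawful structures and used on both sides of a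
  transfer.
* Term and formula combinators with their realizations: finite sums `ExpTerm.sum`, the sign
  `ExpTerm.sign`, determinants `ExpTerm.det` of square matrices of terms (Laplace expansion along
  the first row, realizing to `Matrix.det`), and the atomic formulas `ExpFormula.eq/le/lt`.
* **Transfer of formulas** (`RealExpModel.realize_formula_iff_real`): for a formula `φ` in any type
  of free variables, `φ` holds at every assignment in a model `K` of `T_exp` iff it holds at every
  assignment in `ℝ` (restrict to the finitely many free variables, close universally, and use that
  `T_exp = Th(ℝ_exp)` is complete: `RealExpModel.realize_sentence_iff_real`).
* **Exponential terms are smooth functions on `ℝⁿ`** (`RealExpModel.contDiff_realize`), with strict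
  Fréchet derivative (`hasStrictFDerivAt_realize`) whose value on the `i`-th coordinate vector is the
  realization of Wilkie's formal partial derivative `termPDeriv i t` (`Wilkie1989.lean`;
  `fderiv_realize_single`), as asserted on p. 385 of Wilkie 1989 (terms "identified with the
  corresponding functions", the derivations `∂/∂xᵢ`).

## Mathlib search

Mathlib has the complete theory of a structure (`Language.completeTheory`), `Formula.iAlls`,
`BoundedFormula.restrictFreeVar` (used for the transfer), `ContDiff`, `Real.contDiff_exp`,
`hasDerivAt_update`; it has no real exponential field as a first-order structure and no transfer
principle for it (`RealExpModels.lean` has the sentence version).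

## References

* A. J. Wilkie, *On the theory of the real exponential field*, Illinois J. Math. 33 (1989),
  384–408: §1 p. 385, §2 p. 387.
* D. Marker, *Model Theory: An Introduction*, GTM 217 (2002), §2.2 (complete theories of
  structures; elementary equivalence).
-/

noncomputable section

open FirstOrder FirstOrder.Language FirstOrder.Language.Structure

namespace Literature.ModelTheory.ExponentialFields

namespace RealExpModel

/-! ### Lawful structures: `ℝ` and the models of `T_exp` -/

/-- A `Language.orderedExpRing`-structure on an ordered field `M` is **lawful** if the symbols
`+, *, -, 0, 1, ≤` are interpreted by the field operations and the order of `M` (no condition on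
`exp`).  Both `ℝ_exp` and (the carrier of) every bundled model of `T_exp` are lawful; realization
lemmas are proved once for lawful structures and used on both sides of a transfer argument
(Wilkie 1989, §2 "by transfer"). [folklore] -/
class LawfulStructure (M : Type*) [Language.orderedExpRing.Structure M] [Field M] [LinearOrder M] :
    Prop where
  funMap_add : ∀ v : Fin 2 → M, funMap (L := Language.orderedExpRing) expRingFunc.add v = v 0 + v 1
  funMap_mul : ∀ v : Fin 2 → M, funMap (L := Language.orderedExpRing) expRingFunc.mul v = v 0 * v 1
  funMap_neg : ∀ v : Fin 1 → M, funMap (L := Language.orderedExpRing) expRingFunc.neg v = -v 0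
  funMap_zero : ∀ v : Fin 0 → M, funMap (L := Language.orderedExpRing) expRingFunc.zero v = 0
  funMap_one : ∀ v : Fin 0 → M, funMap (L := Language.orderedExpRing) expRingFunc.one v = 1
  relMap_le : ∀ v : Fin 2 → M,
    RelMap (L := Language.orderedExpRing) Language.orderRel.le v ↔ v 0 ≤ v 1

/-- `ℝ_exp` is lawful (all interpretations hold by `rfl`). [folklore] -/
instance instLawfulStructureReal : LawfulStructure ℝ where
  funMap_add _ := rfl
  funMap_mul _ := rfl
  funMap_neg _ := rfl
  funMap_zero _ := rfl
  funMap_one _ := rfl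
  relMap_le _ := Iff.rfl

/-- Every bundled model of `T_exp` is lawful for the field structure of `RealExpModels.lean`
(whose operations are *defined* as the interpretations of the symbols). [folklore] -/
instance instLawfulStructureModel (K : Language.Theory.ModelType.{0, 0, 0} realExpTheory) :
    LawfulStructure K where
  funMap_add := RealExpModel.funMap_add
  funMap_mul := RealExpModel.funMap_mul
  funMap_neg := RealExpModel.funMap_neg
  funMap_zero := RealExpModel.funMap_zero
  funMap_one := RealExpModel.funMap_one
  relMap_le := RealExpModel.relMap_le

end RealExpModel

/-! ### Realization of the term operations in lawful structures -/

namespace ExpTerm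

variable {M : Type*} [Language.orderedExpRing.Structure M] [Field M] [LinearOrder M]
  [RealExpModel.LawfulStructure M] {α : Type*} (v : α → M)

/-- Realization of the term `0` in a lawful structure. [folklore] -/
@[simp] theorem realize_zero : (0 : Language.orderedExpRing.Term α).realize v = 0 := by
  show (Constants.term _).realize v = 0
  rw [Term.realize_constants]
  exact RealExpModel.LawfulStructure.funMap_zero _

/-- Realization of the term `1` in a lawful structure. [folklore] -/
@[simp] theorem realize_one : (1 : Language.orderedExpRing.Term α).realize v = 1 := by
  show (Constants.term _).realize v = 1
  rw [Term.realize_constants]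
  exact RealExpModel.LawfulStructure.funMap_one _

/-- Realization of `t₁ + t₂` in a lawful structure. [folklore] -/
@[simp] theorem realize_add (t₁ t₂ : Language.orderedExpRing.Term α) :
    (t₁ + t₂).realize v = t₁.realize v + t₂.realize v := by
  show (Functions.apply₂ _ t₁ t₂).realize v = _
  rw [Term.realize_functions_apply₂, RealExpModel.LawfulStructure.funMap_add]
  rfl

/-- Realization of `t₁ * t₂` in a lawful structure. [folklore] -/
@[simp] theorem realize_mul (t₁ t₂ : Language.orderedExpRing.Term α) :
    (t₁ * t₂).realize v = t₁.realize v * t₂.realize v := by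
  show (Functions.apply₂ _ t₁ t₂).realize v = _
  rw [Term.realize_functions_apply₂, RealExpModel.LawfulStructure.funMap_mul]
  rfl

/-- Realization of `-t` in a lawful structure. [folklore] -/
@[simp] theorem realize_neg (t : Language.orderedExpRing.Term α) :
    (-t).realize v = -t.realize v := by
  show (Functions.apply₁ _ t).realize v = _
  rw [Term.realize_functions_apply₁, RealExpModel.LawfulStructure.funMap_neg]
  rfl

/-- Realization of `exp t` in any structure: the interpretation of the symbol `exp` applied to
the realization of `t` (no lawfulness needed). [folklore] -/
theorem realize_termExp_eq_funMap {N : Type*} [Language.orderedExpRing.Structure N] {β : Type*}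
    (w : β → N) (t : Language.orderedExpRing.Term β) :
    (Language.orderedExpRing.termExp t).realize w =
      funMap (L := Language.orderedExpRing) expRingFunc.exp ![t.realize w] := by
  rw [Language.orderedExpRing.termExp, Term.realize_functions_apply₁]

/-- `∂0/∂xᵢ = 0` (by `rfl`). [folklore] -/
@[simp] theorem termPDeriv_zero {κ ι : Type} [DecidableEq ι] (i : ι) :
    RealExpModel.termPDeriv i (0 : Language.orderedExpRing.Term (κ ⊕ ι)) = 0 := rfl

/-- `∂1/∂xᵢ = 0` (by `rfl`). [folklore] -/
@[simp] theorem termPDeriv_one {κ ι : Type} [DecidableEq ι] (i : ι) :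
    RealExpModel.termPDeriv i (1 : Language.orderedExpRing.Term (κ ⊕ ι)) = 0 := rfl

/-! ### Finite sums, signs and determinants of terms -/

/-- The finite sum `t 0 + (t 1 + (⋯ + (t (m-1) + 0)))` of a tuple of terms. [folklore] -/
def sum : {m : ℕ} → (Fin m → Language.orderedExpRing.Term α) → Language.orderedExpRing.Term α
  | 0, _ => 0
  | _ + 1, t => t 0 + sum (fun i => t i.succ)

/-- A finite sum of terms realizes to the sum of the realizations. [folklore] -/
@[simp] theorem realize_sum {m : ℕ} (t : Fin m → Language.orderedExpRing.Term α) :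
    (sum t).realize v = ∑ i, (t i).realize v := by
  induction m with
  | zero => simp [sum]
  | succ m ih => rw [sum, realize_add, ih, Fin.sum_univ_succ]

/-- The term `(-1)ʲ` (as `1` or `-1`). [folklore] -/
def sign (j : ℕ) : Language.orderedExpRing.Term α :=
  if Even j then 1 else -1

/-- `(-1)ʲ` realizes to `(-1) ^ j`. [folklore] -/
@[simp] theorem realize_sign (j : ℕ) : (sign j : Language.orderedExpRing.Term α).realize v = (-1) ^ j := by
  unfold sign
  split_ifs with h
  · rw [realize_one, h.neg_one_pow]
  · rw [realize_neg, realize_one, (Nat.not_even_iff_odd.1 h).neg_one_pow]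

/-- The **determinant** of a square matrix of terms, a term defined by Laplace expansion along the
first row (so that it realizes to `Matrix.det`, `realize_det`). Used for the coefficients of
`dh₁ ∧ ⋯ ∧ dhₚ`, i.e. the minors of a Jacobian matrix of terms (Wilkie 1989, p. 386). [folklore] -/
def det : {m : ℕ} → Matrix (Fin m) (Fin m) (Language.orderedExpRing.Term α) →
    Language.orderedExpRing.Term α
  | 0, _ => 1
  | _ + 1, A => sum fun j => sign (j : ℕ) * A 0 j * det (A.submatrix Fin.succ j.succAbove)

/-- The determinant term realizes to the determinant of the matrix of realizations. [folklore] -/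
@[simp] theorem realize_det {m : ℕ} (A : Matrix (Fin m) (Fin m) (Language.orderedExpRing.Term α)) :
    (det A).realize v = (A.map fun t => t.realize v).det := by
  induction m with
  | zero => simp [det]
  | succ m ih =>
    rw [det, realize_sum, Matrix.det_succ_row_zero]
    refine Finset.sum_congr rfl fun j _ => ?_
    rw [realize_mul, realize_mul, realize_sign, ih]
    rfl

end ExpTerm

/-! ### Atomic formulas and their realizations -/

namespace ExpFormula

variable {α : Type*}

/-- The formula `t₁ = t₂`. [folklore] -/
def eq (t₁ t₂ : Language.orderedExpRing.Term α) : Language.orderedExpRing.Formula α :=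
  Term.equal t₁ t₂

/-- The formula `t₁ ≤ t₂`. [folklore] -/
def le (t₁ t₂ : Language.orderedExpRing.Term α) : Language.orderedExpRing.Formula α :=
  Relations.formula₂ Language.orderRel.le t₁ t₂

/-- The formula `t₁ < t₂`, written `¬ (t₂ ≤ t₁)`. [folklore] -/
def lt (t₁ t₂ : Language.orderedExpRing.Term α) : Language.orderedExpRing.Formula α :=
  (le t₂ t₁).not

/-- Realization of `t₁ = t₂`. [folklore] -/
@[simp] theorem realize_eq {M : Type*} [Language.orderedExpRing.Structure M] (v : α → M)
    (t₁ t₂ : Language.orderedExpRing.Term α) :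
    (eq t₁ t₂).Realize v ↔ t₁.realize v = t₂.realize v := by
  simp [eq]

variable {M : Type*} [Language.orderedExpRing.Structure M] [Field M] [LinearOrder M]
  [RealExpModel.LawfulStructure M] (v : α → M)

/-- Realization of `t₁ ≤ t₂` in a lawful structure. [folklore] -/
@[simp] theorem realize_le (t₁ t₂ : Language.orderedExpRing.Term α) :
    (le t₁ t₂).Realize v ↔ t₁.realize v ≤ t₂.realize v := by
  rw [le, Formula.realize_rel₂, RealExpModel.LawfulStructure.relMap_le]
  simp only [Matrix.cons_val_zero, Matrix.cons_val_one]

/-- Realization of `t₁ < t₂` in a lawful structure. [folklore] -/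
@[simp] theorem realize_lt (t₁ t₂ : Language.orderedExpRing.Term α) :
    (lt t₁ t₂).Realize v ↔ t₁.realize v < t₂.realize v := by
  rw [lt, Formula.realize_not, realize_le, not_le]

end ExpFormula

namespace RealExpModel

/-! ### Transfer of formulas -/

section Transfer

variable (K : Language.Theory.ModelType.{0, 0, 0} realExpTheory)

/-- The universal closure of a formula over its (finitely many) free variables, as a sentence.
[folklore] -/
def closure {α : Type*} [DecidableEq α] (φ : Language.orderedExpRing.Formula α) :
    Language.orderedExpRing.Sentence :=
  Formula.iAlls (↥φ.freeVarFinset)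
    (Formula.relabel Sum.inr
      (φ.restrictFreeVar (_root_.id : φ.freeVarFinset → ↥φ.freeVarFinset)))

/-- A structure satisfies the universal closure of `φ` iff `φ` holds at every assignment.
[folklore] -/
theorem realize_closure_iff {α : Type*} [DecidableEq α] (φ : Language.orderedExpRing.Formula α)
    (M : Type*) [Language.orderedExpRing.Structure M] [Nonempty M] :
    M ⊨ closure φ ↔ ∀ v : α → M, φ.Realize v := by
  rw [closure, Sentence.Realize, Formula.realize_iAlls]
  refine ⟨?_, ?_⟩
  · intro h v
    have h1 := h (v ∘ (↑))
    rw [Formula.realize_relabel] at h1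
    have h2 : Formula.Realize
        (φ.restrictFreeVar (_root_.id : φ.freeVarFinset → ↥φ.freeVarFinset)) (v ∘ (↑)) ↔
        φ.Realize v := by
      simpa [Formula.Realize] using
        (BoundedFormula.realize_restrictFreeVar (φ := φ) (f := _root_.id) (v := v ∘ (↑))
          (xs := default) v (fun a => rfl))
    exact h2.1 h1
  · intro h i
    rw [Formula.realize_relabel]
    obtain ⟨m⟩ := (inferInstance : Nonempty M)
    -- extend the finite assignment `i` to all variables
    let v : α → M := fun a => if ha : a ∈ φ.freeVarFinset then i ⟨a, ha⟩ else m
    have hv : v ∘ ((↑) : φ.freeVarFinset → α) = i := by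
      funext a
      simp [v, Function.comp]
    have h2 : Formula.Realize
        (φ.restrictFreeVar (_root_.id : φ.freeVarFinset → ↥φ.freeVarFinset)) (v ∘ (↑)) ↔
        φ.Realize v := by
      simpa [Formula.Realize] using
        (BoundedFormula.realize_restrictFreeVar (φ := φ) (f := _root_.id) (v := v ∘ (↑))
          (xs := default) v (fun a => rfl))
    have h3 := h2.2 (h v)
    rw [hv] at h3
    exact h3

/-- **Transfer of formulas** (Wilkie 1989, §2 "by transfer"): a formula of the language of ordered
exponential rings, in any type of free variables, holds at every assignment in a model `K` of
`T_exp = Th(ℝ_exp)` iff it holds at every assignment in `ℝ`. [cite: Wilkie1989, §2, p. 387] -/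
theorem realize_formula_iff_real {α : Type*} (φ : Language.orderedExpRing.Formula α) :
    (∀ v : α → K, φ.Realize v) ↔ ∀ v : α → ℝ, φ.Realize v := by
  classical
  rw [← realize_closure_iff, ← realize_closure_iff]
  exact realize_sentence_iff_real K _

/-- **Transfer of formulas**, the direction used in practice: what holds identically in `ℝ_exp`
holds identically in every model of `T_exp`. [cite: Wilkie1989, §2, p. 387] -/
theorem realize_formula_of_real {α : Type*} (φ : Language.orderedExpRing.Formula α)
    (h : ∀ v : α → ℝ, φ.Realize v) (v : α → K) : φ.Realize v :=
  (realize_formula_iff_real K φ).2 h v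

end Transfer

/-! ### Exponential terms as smooth functions on `ℝⁿ` -/

section Smooth

variable {κ ι : Type}

/-- **Exponential terms define smooth functions on `ℝⁿ`**: the function `x ↦ t(a, x)` defined by a
term `t` with parameters (at values `a`) is `Cⁿ` for every `n` (by induction on the term:
coordinates, constants, `+`, `*`, `-`, `exp` are smooth; Wilkie 1989, p. 385, identifies terms
with "the corresponding functions"). [cite: Wilkie1989, §1, p. 385] -/
theorem contDiff_realize [Fintype ι] (t : Language.orderedExpRing.Term (κ ⊕ ι)) (a : κ → ℝ)
    {n : WithTop ℕ∞} : ContDiff ℝ n (fun x : ι → ℝ => t.realize (Sum.elim a x)) := by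
  induction t with
  | var v =>
    rcases v with c | j
    · simpa using contDiff_const (c := a c)
    · simpa using (contDiff_apply ℝ ℝ j)
  | func f ts ih =>
    cases f with
    | add =>
      have := (ih 0).add (ih 1)
      simpa [Term.realize] using this
    | mul =>
      have := (ih 0).mul (ih 1)
      simpa [Term.realize] using this
    | neg =>
      have := (ih 0).neg
      simpa [Term.realize] using this
    | zero => simpa [Term.realize] using contDiff_const (c := (0 : ℝ))
    | one => simpa [Term.realize] using contDiff_const (c := (1 : ℝ))
    | exp =>
      have := (ih 0).exp
      simpa [Term.realize] using this

/-- Exponential terms define continuous functions on `ℝⁿ`. [folklore] -/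
theorem continuous_realize [Fintype ι] (t : Language.orderedExpRing.Term (κ ⊕ ι)) (a : κ → ℝ) :
    Continuous (fun x : ι → ℝ => t.realize (Sum.elim a x)) :=
  (contDiff_realize t a (n := 0)).continuous

/-- Exponential terms are strictly differentiable at every point of `ℝⁿ`. [folklore] -/
theorem hasStrictFDerivAt_realize [Fintype ι] (t : Language.orderedExpRing.Term (κ ⊕ ι))
    (a : κ → ℝ) (x : ι → ℝ) :
    HasStrictFDerivAt (fun x : ι → ℝ => t.realize (Sum.elim a x))
      (fderiv ℝ (fun x : ι → ℝ => t.realize (Sum.elim a x)) x) x :=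
  (contDiff_realize t a (n := 1)).contDiffAt.hasStrictFDerivAt (by simp)

/-- **The formal partial derivative is the partial derivative**: the Fréchet derivative of the
function defined by `t`, evaluated on the `i`-th coordinate vector, is the realization of
`termPDeriv i t` (Wilkie 1989, p. 385). [cite: Wilkie1989, §1, p. 385] -/
theorem fderiv_realize_single [Fintype ι] [DecidableEq ι]
    (t : Language.orderedExpRing.Term (κ ⊕ ι)) (a : κ → ℝ) (x : ι → ℝ) (i : ι) :
    fderiv ℝ (fun x : ι → ℝ => t.realize (Sum.elim a x)) x (Pi.single i 1) =
      (termPDeriv i t).realize (Sum.elim a x) := by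
  have h1 : HasDerivAt (fun s : ℝ => t.realize (Sum.elim a (Function.update x i s)))
      (fderiv ℝ (fun x : ι → ℝ => t.realize (Sum.elim a x)) x (Pi.single i 1)) (x i) := by
    have hf : HasFDerivAt (fun x : ι → ℝ => t.realize (Sum.elim a x))
        (fderiv ℝ (fun x : ι → ℝ => t.realize (Sum.elim a x)) x) (Function.update x i (x i)) := by
      rw [Function.update_eq_self]
      exact (hasStrictFDerivAt_realize t a x).hasFDerivAt
    exact hf.comp_hasDerivAt (x i) (hasDerivAt_update x i (x i))
  have h2 : HasDerivAt (fun s : ℝ => t.realize (Sum.elim a (Function.update x i s)))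
      ((termPDeriv i t).realize (Sum.elim a x)) (x i) :=
    hasDerivAt_realize_termPDeriv a x i t
  exact h1.unique h2

end Smooth

end RealExpModel

end Literature.ModelTheory.ExponentialFields
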